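import Summits.ValiantsHypothesis.ValiantsHypothesis.Theorems.KPlusLogSqLawTropicalStaticMountainHull

/-!
# Route «KPlusLogSqLaw» — the static family MOUNTAIN, part 4: the structure lemma and DOMINANCE

HONEST FRAMING.  Helper chain of the object-search cell `pub-symmetroid` (seat val-sym-lift-p1 g5, 2026-08-27) toward
the cruxes `WeakLifting` (ledger item `stmt-ValiantsHypothesis-19561`) / `TropicalB` (`stmt-ValiantsHypothesis-19771`) of
route `KPlusLogSqLaw`, in the vocabulary of `…CensusTropicalKLaw` / `…CensusTropicalKLawStatic` (`TropRootLawAt`,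
`TropRootLawAtStatic`, `IsStatic`, `IsDominant`, `termSign`, `tropWeight`).  It is a statement of FINITE TROPICAL
COMBINATORICS (an explicit dominance design per format `(m, 3)` and its chain); nothing here asserts or bears on `TropicalB`,
`WeakLifting`, `Lifting`, `KPlusLogSqLaw`, the cell's real census or registers (DoorA26 / DoorA34), `MatrixDescartes`
(`stmt-ValiantsHypothesis-18050`) or `VP ≠ VNP`.

Proved here (sorry-free):
* STRUCTURE LEMMA (`eq_mtn_of_land`): a supported permutation (`σ b ∈ {b+1} ∪ [0, b]` for `b ≥ 1`) with `σ 0 = z ≥ 1`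
  whose descents all land below `z` and cover every row below `z` IS a mountain `M_(y,z)`;
* CLAIM A (`claimA`, within-histogram optimality): a supported permutation with `z ≥ 1` anti-excedances is a mountain or
  costs strictly more than every `W(y', z)` — by the cost lower bound, the subset-sum lemmas and the case analysis on `σ 0`
  versus `z` (the row `σ 0` is never a landing row);
* **`isDominant_mterm`**: for every admissible `(y, z)` (and for `(0,0)` at `θ = −1`) the mountain term is the UNIQUE optimum
  of the design among all present Leibniz terms at the slope `θ(y,z)` — Claim A plus the hull of part 3.
-/

-- `Summit.ValiantsHypothesis.ValiantsHypothesis.…` repeats a component by the D-0017 layout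
-- (single-conjunct summit), which the `dupNamespace` linter flags; the name is mandated.
set_option linter.dupNamespace false
set_option autoImplicit false

namespace Summit.ValiantsHypothesis.ValiantsHypothesis.Theorems.LacunarySymmetroidMatrixDescartes.TropicalCensus

open Summit.ValiantsHypothesis.ValiantsHypothesis.Theorems.MatrixDescartes.Negative
open scoped BigOperators
open Finset

namespace Mountain

variable (n : ℕ)

/-- **structure lemma.**  A supported permutation (`σ b ∈ {b+1, b} ∪ [0,b)` for `b ≥ 1`) with `σ 0 = z ≥ 1`, all of
whose descents land below `z` and which lands on every row below `z`, is a mountain `M_{y,z}`. -/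
theorem eq_mtn_of_land (σ : Equiv.Perm (Fin (n + 1))) (z : ℕ) (hz : 1 ≤ z)
    (hpres : ∀ b : Fin (n + 1), (b : ℕ) ≠ 0 → (b : ℕ) < ((σ b : Fin (n + 1)) : ℕ) →
      ((σ b : Fin (n + 1)) : ℕ) = (b : ℕ) + 1)
    (h0 : ((σ 0 : Fin (n + 1)) : ℕ) = z)
    (hland : ∀ b : Fin (n + 1), ((σ b : Fin (n + 1)) : ℕ) < (b : ℕ) → ((σ b : Fin (n + 1)) : ℕ) < z)
    (hcover : ∀ a : ℕ, a < z → ∃ b : Fin (n + 1), ((σ b : Fin (n + 1)) : ℕ) = a ∧ a < (b : ℕ)) :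
    ∃ y, (1 ≤ y ∧ 1 ≤ z ∧ y + z ≤ n + 1) ∧ σ = mtn n y z := by
  have hzn : z ≤ n := by have := (σ 0).isLt; omega
  have val0 : ((0 : Fin (n + 1)) : ℕ) = 0 := rfl
  -- S1: the columns `1 ≤ b < z` descend
  have S1 : ∀ b : Fin (n + 1), 1 ≤ (b : ℕ) → (b : ℕ) < z → ((σ b : Fin (n + 1)) : ℕ) < (b : ℕ) := by
    intro b hb1 hbz
    by_contra hcon
    push Not at hcon
    rcases hcon.lt_or_eq with hlt | heq
    · have hs := hpres b (by omega) hlt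
      by_cases hb' : (b : ℕ) + 1 < z
      · obtain ⟨b', hb'1, hb'2⟩ := hcover ((b : ℕ) + 1) hb'
        have he : b' = b := σ.injective (Fin.ext (by rw [hb'1, hs]))
        rw [he] at hb'2; omega
      · have he : b = 0 := σ.injective (Fin.ext (by rw [hs, h0]; omega))
        rw [he, val0] at hb1; omega
    · obtain ⟨b', hb'1, hb'2⟩ := hcover (b : ℕ) hbz
      have he : b' = b := σ.injective (Fin.ext (by rw [hb'1, heq]))
      rw [he] at hb'2; exact lt_irrefl _ hb'2
  -- S2: `σ b = b − 1` for `1 ≤ b < z`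
  have S2 : ∀ k : ℕ, ∀ b : Fin (n + 1), (b : ℕ) = k → 1 ≤ k → k < z → ((σ b : Fin (n + 1)) : ℕ) = k - 1 := by
    intro k
    induction k using Nat.strong_induction_on with
    | _ k ih =>
      intro b hbk hk1 hkz
      have hlt := S1 b (by omega) (by omega)
      by_contra hne
      have ha2 : ((σ b : Fin (n + 1)) : ℕ) + 2 ≤ k := by omega
      have hb1 : ((σ b : Fin (n + 1)) : ℕ) + 1 < n + 1 := by omega
      have hih := ih (((σ b : Fin (n + 1)) : ℕ) + 1) (by omega) ⟨_, hb1⟩ rfl (by omega) (by omega)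
      have heq : (⟨((σ b : Fin (n + 1)) : ℕ) + 1, hb1⟩ : Fin (n + 1)) = b :=
        σ.injective (Fin.ext (by rw [hih]; simp))
      have hv := congrArg Fin.val heq
      simp only at hv
      omega
  -- S3: the column `bs ≥ z` landing at row `z − 1`
  obtain ⟨bs, hbs1, hbs2⟩ := hcover (z - 1) (by omega)
  have hbsz : z ≤ (bs : ℕ) := by
    by_contra hcon; push Not at hcon
    have := S2 (bs : ℕ) bs rfl (by omega) hcon
    omega
  -- S4: columns `≥ z` other than `bs` do not descend
  have S4 : ∀ b : Fin (n + 1), z ≤ (b : ℕ) → b ≠ bs → (b : ℕ) ≤ ((σ b : Fin (n + 1)) : ℕ) := by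
    intro b hb hne
    by_contra hcon; push Not at hcon
    have hl := hland b hcon
    by_cases haz : ((σ b : Fin (n + 1)) : ℕ) + 1 < z
    · have hb1 : ((σ b : Fin (n + 1)) : ℕ) + 1 < n + 1 := by omega
      have hih := S2 (((σ b : Fin (n + 1)) : ℕ) + 1) ⟨_, hb1⟩ rfl (by omega) haz
      have heq : (⟨((σ b : Fin (n + 1)) : ℕ) + 1, hb1⟩ : Fin (n + 1)) = b :=
        σ.injective (Fin.ext (by rw [hih]; simp))
      have hv := congrArg Fin.val heq
      simp only at hv
      omega
    · have heq : bs = b := σ.injective (Fin.ext (by rw [hbs1]; omega))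
      exact hne heq.symm
  -- S5: columns above `bs` are fixed
  have S5 : ∀ d : ℕ, ∀ b : Fin (n + 1), (b : ℕ) + d = n → (bs : ℕ) < (b : ℕ) →
      ((σ b : Fin (n + 1)) : ℕ) = (b : ℕ) := by
    intro d
    induction d with
    | zero =>
      intro b hbd hb
      have h1 := S4 b (by omega) (fun h => by rw [h] at hb; exact lt_irrefl _ hb)
      have := (σ b).isLt
      omega
    | succ d ih =>
      intro b hbd hb
      have h1 := S4 b (by omega) (fun h => by rw [h] at hb; exact lt_irrefl _ hb)
      rcases h1.lt_or_eq with hlt | heq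
      · have hs := hpres b (by omega) hlt
        have hb1 : (b : ℕ) + 1 < n + 1 := by omega
        have hih := ih ⟨(b : ℕ) + 1, hb1⟩ (by simp only; omega) (by simp only; omega)
        have heq : (⟨(b : ℕ) + 1, hb1⟩ : Fin (n + 1)) = b := σ.injective (Fin.ext (by rw [hih, hs]))
        have hv := congrArg Fin.val heq
        simp only at hv
        omega
      · exact heq.symm
  have S5' : ∀ b : Fin (n + 1), (bs : ℕ) < (b : ℕ) → ((σ b : Fin (n + 1)) : ℕ) = (b : ℕ) :=
    fun b hb => S5 (n - (b : ℕ)) b (by have := b.isLt; omega) hb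
  -- S6: columns in `[z, bs)` ascend by one
  have S6 : ∀ d : ℕ, ∀ c : Fin (n + 1), (c : ℕ) + 1 + d = (bs : ℕ) → z ≤ (c : ℕ) →
      ((σ c : Fin (n + 1)) : ℕ) = (c : ℕ) + 1 := by
    intro d
    induction d with
    | zero =>
      intro c hcd hzc
      have ht : (c : ℕ) + 1 < n + 1 := by have := bs.isLt; omega
      obtain ⟨c', hc'⟩ := σ.surjective ⟨(c : ℕ) + 1, ht⟩
      have hc'v : ((σ c' : Fin (n + 1)) : ℕ) = (c : ℕ) + 1 := by rw [hc']
      -- locate `c'`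
      have hc'0 : (c' : ℕ) ≠ 0 := by
        intro h; have : c' = 0 := Fin.ext h; rw [this, h0] at hc'v; omega
      have hc'z : ¬ ((c' : ℕ) < z) := by
        intro h; have := S2 (c' : ℕ) c' rfl (by omega) h; omega
      have hc'bs : c' ≠ bs := by
        intro h; rw [h, hbs1] at hc'v; omega
      have hc'le : (c' : ℕ) ≤ (bs : ℕ) := by
        by_contra h; push Not at h
        have := S5' c' h; omega
      have hc'lt : (c' : ℕ) < (bs : ℕ) := lt_of_le_of_ne hc'le (fun h => hc'bs (Fin.ext h))
      have h4 := S4 c' (by omega) hc'bs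
      rcases h4.lt_or_eq with hlt | heq
      · have hs := hpres c' hc'0 hlt
        have : c' = c := Fin.ext (by omega)
        rw [this] at hc'v; exact hc'v
      · -- `c'` fixed with `σ c' = c + 1 = bs`: contradiction with `c' < bs`
        omega
    | succ d ih =>
      intro c hcd hzc
      have ht : (c : ℕ) + 1 < n + 1 := by have := bs.isLt; omega
      obtain ⟨c', hc'⟩ := σ.surjective ⟨(c : ℕ) + 1, ht⟩
      have hc'v : ((σ c' : Fin (n + 1)) : ℕ) = (c : ℕ) + 1 := by rw [hc']
      have hc'0 : (c' : ℕ) ≠ 0 := by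
        intro h; have : c' = 0 := Fin.ext h; rw [this, h0] at hc'v; omega
      have hc'z : ¬ ((c' : ℕ) < z) := by
        intro h; have := S2 (c' : ℕ) c' rfl (by omega) h; omega
      have hc'bs : c' ≠ bs := by
        intro h; rw [h, hbs1] at hc'v; omega
      have hc'le : (c' : ℕ) ≤ (bs : ℕ) := by
        by_contra h; push Not at h
        have := S5' c' h; omega
      have hc'lt : (c' : ℕ) < (bs : ℕ) := lt_of_le_of_ne hc'le (fun h => hc'bs (Fin.ext h))
      have h4 := S4 c' (by omega) hc'bs
      rcases h4.lt_or_eq with hlt | heq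
      · have hs := hpres c' hc'0 hlt
        have : c' = c := Fin.ext (by omega)
        rw [this] at hc'v; exact hc'v
      · -- `c'` fixed at `c + 1 < bs`: but by induction `σ (c+1) = c + 2`
        have hih := ih c' (by omega) (by omega)
        omega
  -- conclusion: `σ = M_{y,z}` with `y = bs − z + 1`
  refine ⟨(bs : ℕ) - z + 1, ⟨by omega, hz, by have := bs.isLt; omega⟩, ?_⟩
  have hadm : 1 ≤ (bs : ℕ) - z + 1 ∧ 1 ≤ z ∧ ((bs : ℕ) - z + 1) + z ≤ n + 1 :=
    ⟨by omega, hz, by have := bs.isLt; omega⟩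
  apply Equiv.ext
  intro i
  apply Fin.ext
  rw [mtn_val n hadm]
  by_cases hi0 : (i : ℕ) = 0
  · rw [hi0, mf_at0]
    have : i = 0 := Fin.ext hi0
    rw [this, h0]
  by_cases hi1 : (i : ℕ) < z
  · rw [mf_desc _ _ _ (by omega) hi1]
    exact S2 (i : ℕ) i rfl (by omega) hi1
  by_cases hi2 : (i : ℕ) < (bs : ℕ)
  · rw [mf_asc _ _ _ (by omega) (by omega) hz]
    exact S6 ((bs : ℕ) - (i : ℕ) - 1) i (by omega) (by omega)
  by_cases hi3 : (i : ℕ) = (bs : ℕ)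
  · rw [mf_top _ _ _ (by omega) hz (by omega)]
    have : i = bs := Fin.ext hi3
    rw [this, hbs1]
  · rw [mf_fix _ _ _ (by omega) hz]
    exact S5' i (by omega)

/-- **Claim A (within-histogram optimality).**  A supported permutation with `z ≥ 1` anti-excedances is either a
mountain `M_{y,z}` or costs strictly more than every `W(y', z)`. -/
theorem claimA (σ : Equiv.Perm (Fin (n + 1))) (z : ℕ) (hzdef : aexc n σ = z)
    (hpres : ∀ b : Fin (n + 1), sgn n (σ b) b ≠ 0) (hz : 1 ≤ z) :
    (∃ y, (1 ≤ y ∧ 1 ≤ z ∧ y + z ≤ n + 1) ∧ σ = mtn n y z) ∨ ∀ y, y ≤ n + 1 → Wv n y z < cost n σ := by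
  have hcost := cost_ge_land n σ
  have hcard : (land n σ).card = z := by rw [land_card, hzdef]
  by_cases hL : land n σ = range z
  · have hc : z ≤ ((σ 0 : Fin (n + 1)) : ℕ) := by
      by_contra h; push Not at h
      have := sigma_zero_not_mem_land n σ
      rw [hL] at this
      exact this (Finset.mem_range.mpr h)
    rcases hc.lt_or_eq with hlt | heq
    · right; intro y hy
      have h1 : Q n ^ (z + 1) - Q n ≤ c0 n σ := by
        unfold c0; rw [if_pos (by omega)]
        have := Q_pow_mono n (show z + 1 ≤ ((σ 0 : Fin (n + 1)) : ℕ) by omega)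
        linarith
      have h2 : ∑ a ∈ land n σ, Q n ^ a * (Q n - 1) = Q n ^ z - 1 := by rw [hL, geom]
      have := boundA n y z hz hy
      linarith
    · left
      refine eq_mtn_of_land n σ z hz ?_ heq.symm ?_ ?_
      · intro b hb0 hlt
        exact unitAsc_of_sgn_ne_zero n (σ b) b (hpres b) hlt hb0
      · intro b hb
        have hm : ((σ b : Fin (n + 1)) : ℕ) ∈ land n σ := (mem_land n σ _).mpr ⟨b, rfl, hb⟩
        rw [hL, Finset.mem_range] at hm
        exact hm
      · intro a ha
        have hm : a ∈ land n σ := by rw [hL]; exact Finset.mem_range.mpr ha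
        obtain ⟨i, hi1, hi2⟩ := (mem_land n σ a).mp hm
        exact ⟨i, hi1, by rw [← hi1]; exact hi2⟩
  · right; intro y hy
    have hne : land n σ ≠ range (land n σ).card := by rw [hcard]; exact hL
    have hnonempty : (land n σ).Nonempty := by rw [← Finset.card_pos, hcard]; exact hz
    have h1 := sum_range_card_le' (fun a => Q n ^ a * (Q n - 1)) (beta_mono n) (land n σ) hnonempty hne
    simp only [hcard] at h1
    rw [geom] at h1
    have h2 := c0_nonneg n σ
    have := boundB n y z hz hy
    linarith

/-- the weight of a static term is `θ·deg − cost`. -/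
theorem tropWeight_static (σ : Equiv.Perm (Fin (n + 1))) (θ : ℤ) :
    tropWeight (dd n) (vv n) θ (σ, fun b => cls n (σ b) b) = θ * deg n σ - cost n σ := by
  unfold tropWeight deg cost vv
  rfl

/-- every entry of a mountain is present. -/
theorem sgn_mtn_ne_zero (y z : ℕ) (h : (y = 0 ∧ z = 0) ∨ (1 ≤ y ∧ 1 ≤ z ∧ y + z ≤ n + 1)) (b : Fin (n + 1)) :
    sgn n (mtn n y z b) b ≠ 0 := by
  rcases h with ⟨rfl, rfl⟩ | h
  · rw [mtn_zero_zero, Equiv.Perm.coe_one, id_eq, sgn_diag]; exact one_ne_zero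
  · have hv := mtn_val n h b
    by_cases h0 : (b : ℕ) = 0
    · rw [sgn_col0 n _ _ (by rw [hv, h0, mf_at0]; omega) h0]; exact csign_ne_zero n _
    by_cases h1 : (b : ℕ) < z
    · have hvb : ((mtn n y z b : Fin (n + 1)) : ℕ) = (b : ℕ) - 1 := by rw [hv, mf_desc y z b (by omega) h1]
      rw [sgn_unitDesc n _ _ (by rw [hvb]; omega) (by rw [hvb]; omega)]; exact one_ne_zero
    by_cases h2 : (b : ℕ) + 1 < z + y
    · have hvb : ((mtn n y z b : Fin (n + 1)) : ℕ) = (b : ℕ) + 1 := by rw [hv, mf_asc y z b (by omega) h2 h.2.1]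
      rw [sgn_unitAsc n _ _ (by rw [hvb]; omega) h0 hvb]; exact one_ne_zero
    by_cases h3 : (b : ℕ) + 1 = z + y
    · have hvb : ((mtn n y z b : Fin (n + 1)) : ℕ) = z - 1 := by rw [hv, mf_top y z b h3 h.2.1 h.1]
      by_cases hy1 : y = 1
      · rw [sgn_unitDesc n _ _ (by rw [hvb]; omega) (by rw [hvb]; omega)]; exact one_ne_zero
      · rw [sgn_longDesc n _ _ (by rw [hvb]; omega) (by rw [hvb]; omega)]; exact lsign_ne_zero n _ _
    · have hvb : ((mtn n y z b : Fin (n + 1)) : ℕ) = (b : ℕ) := by rw [hv, mf_fix y z b (by omega) h.2.1]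
      rw [show mtn n y z b = b from Fin.ext hvb, sgn_diag]; exact one_ne_zero

/-- the mountain term is present. -/
theorem termSign_mterm_ne_zero (y z : ℕ) (h : (y = 0 ∧ z = 0) ∨ (1 ≤ y ∧ 1 ≤ z ∧ y + z ≤ n + 1)) :
    termSign (ee n) (mterm n y z) ≠ 0 := by
  unfold termSign mterm
  refine mul_ne_zero (Units.ne_zero _) ?_
  rw [Finset.prod_ne_zero_iff]
  intro b _
  dsimp only
  unfold ee
  rw [if_pos rfl]
  exact sgn_mtn_ne_zero n y z h b

/-- the weight of the mountain term at its own slope. -/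
theorem tropWeight_mterm (y z : ℕ) (h : (y = 0 ∧ z = 0) ∨ (1 ≤ y ∧ 1 ≤ z ∧ y + z ≤ n + 1)) (θ : ℤ) :
    tropWeight (dd n) (vv n) θ (mterm n y z) = θ * Dg n y z - Wv n y z := by
  unfold mterm
  rw [tropWeight_static]
  rcases h with ⟨rfl, rfl⟩ | h
  · rw [mtn_zero_zero, deg_one, cost_one]; unfold Dg Wv; simp
  · rw [deg_mtn n h, cost_mtn n h]

/-- **MAIN LEMMA: the mountain term `M_{y,z}` is the unique optimum of the design at the slope `θ(y,z)`** (and the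
identity term at `θ = −1`). -/
theorem isDominant_mterm (y z : ℕ) (h : (y = 0 ∧ z = 0) ∨ (1 ≤ y ∧ 1 ≤ z ∧ y + z ≤ n + 1)) :
    IsDominant (dd n) (vv n) (ee n) (th n y z) (mterm n y z) := by
  refine ⟨termSign_mterm_ne_zero n y z h, ?_⟩
  intro q hq hqs
  obtain ⟨σ, μ⟩ := q
  have hpres : ∀ i, ee n (σ i) i (μ i) ≠ 0 := fun i => present_of_termSign_ne_zero (ee n) (σ, μ) hqs i
  have hμ : μ = fun b => cls n (σ b) b := funext fun i => (cls_of_ee_ne_zero n _ _ _ (hpres i)).1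
  have hsgn : ∀ i, sgn n (σ i) i ≠ 0 := fun i => (cls_of_ee_ne_zero n _ _ _ (hpres i)).2
  subst hμ
  rw [tropWeight_static, tropWeight_mterm n y z h]
  obtain ⟨z', hz'⟩ : ∃ z', aexc n σ = z' := ⟨_, rfl⟩
  obtain ⟨y', hy'⟩ : ∃ y', exc n σ = y' := ⟨_, rfl⟩
  have hdeg : deg n σ = Dg n y' z' := by rw [deg_eq, hz', hy']; rfl
  rw [hdeg]
  rcases Nat.eq_zero_or_pos z' with hz0 | hz1
  · -- the competitor is the identity
    have hσ1 : σ = 1 := eq_one_of_aexc_eq_zero n σ (by rw [hz', hz0])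
    subst hσ1
    have hy0 : y' = 0 := by rw [← hy', exc_one]
    rw [hz0, hy0, cost_one]
    have hne : (y, z) ≠ (0, 0) := by
      intro hyz
      obtain ⟨rfl, rfl⟩ := Prod.mk.inj hyz
      apply hq
      unfold mterm; rw [mtn_zero_zero]
    have := hull n y z 0 0 h (Or.inl ⟨rfl, rfl⟩) hne
    have hW0 : Wv n 0 0 = 0 := by unfold Wv; rw [if_pos rfl]
    rw [hW0] at this
    linarith
  · have hy1 : 1 ≤ y' := by rw [← hy']; exact one_le_exc n σ (by rw [hz']; exact hz1)
    have hyz : y' + z' ≤ n + 1 := by rw [← hy', ← hz']; exact exc_add_aexc_le n σ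
    rcases claimA n σ z' hz' hsgn hz1 with ⟨y'', hy'', hσm⟩ | hgt
    · -- the competitor is another mountain
      subst hσm
      have hy''eq : y' = y'' := by rw [← hy', exc_mtn n hy'']
      subst hy''eq
      have hne : (y, z) ≠ (y', z') := by
        intro hyz
        obtain ⟨rfl, rfl⟩ := Prod.mk.inj hyz
        exact hq rfl
      have := hull n y z y' z' h (Or.inr hy'') hne
      rw [cost_mtn n hy'']
      linarith
    · have h1 := hgt y' (by omega)
      have h2 := hull_le n y z y' z' h (Or.inr ⟨hy1, hz1, hyz⟩)
      linarith

end Mountain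

end Summit.ValiantsHypothesis.ValiantsHypothesis.Theorems.LacunarySymmetroidMatrixDescartes.TropicalCensus
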